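import Summits.BirchSwinnertonDyer.BirchSwinnertonDyer.Theorems.UniversalToricDescentResidualSelmerTransfer
import Summits.BirchSwinnertonDyer.Rank1Residual.O5.HeegnerLogTransportThreeResidualEngine
import HarnessLib

/-!
# Route UniversalToricDescent — the EXACT residual comparison
# `Sel_𝔭^Σ(K_∞, E[p^∞])[p] ≅ R_𝔭^Σ(K_∞, E[p]) ≅ R_𝔭^Σ(K_∞, E′[p]) ≅ Sel_𝔭^Σ(K_∞, E′[p^∞])[p]`
# (port-grade algebraic half of child 20399 / `InvariantsTransportModThreeT` (21845), step (X) of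
# PRICING-20399-ALG-HALF-utdp1g5 §2: the input of the λ-transfer §3(c))

Lead prover bsd-wall-utd-p1 g6 (`--supports stmt-BirchSwinnertonDyer-20399`). The files
`UniversalToricDescentResidualSelmer{Transport,Finite,Comparison,Local,Transfer}` transport FINITENESS of the
`p`-torsion of Castella's anticyclotomic Selmer group along `E[p] ≅ E′[p]` (enough for «torsion, `μ = 0`»).
For the λ-invariant one needs the comparison to be EXACT. This file proves, for an elliptic curve `E = W/K`
over a number field, ANY `ℤ_p`-extension `K_∞ = K̄^H` (`H = ker κ`), `p` odd, `𝔭 ∋ p`, `Σ ∌ 𝔭` containing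
the bad places prime to `p`, under the single local hypothesis
  (L) `E[p^∞]^{H ⊓ D_𝔭}` has no `p`-torsion (i.e. `E(K_{∞,𝔭})[p] = 0` at the STRICT place),
that the Kummer map `ι = (E[p] ↪ E[p^∞])_* : H¹(H, E[p]) → H¹(H, E[p^∞])` satisfies
* §2 `comap_torsionToPrimaryH1Sub_selmerAc_eq_residualSelmer`: `ι⁻¹(Sel_𝔭^Σ(K_∞, E[p^∞])) = R_𝔭^Σ(K_∞, E[p])`
  — at the good places `v ∉ Σ` «locally trivial for `E[p^∞]`» pulls back to «unramified for `E[p]`»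
  (`mem_unramifiedKer_of_torsionToPrimaryH1Sub_mem_awayKer` / the local lemma (H)
  `torsionToPrimaryH1Sub_mem_awayKer_of_mem_unramifiedKer_kerSubgroup`), at `𝔭` the strict condition pulls
  back to the strict condition because the local Kummer kernel `E(K_{∞,𝔭})[p^∞]/p` vanishes under (L)
  (`torsionToPrimaryH1Sub_injective_of_fixed` for `H ⊓ D_𝔭`), the other places above `p` carry no
  condition on either side, the archimedean conditions are vacuous for odd `p`;
* §2 `natCard_residualSelmer_eq_natCard_selmerAc_pTorsion`: `ι` restricts to a BIJECTION
  `R_𝔭^Σ(K_∞, E[p]) ≃ Sel_𝔭^Σ(K_∞, E[p^∞])[p]` — injective because (L) forces `E(K_∞)[p] = 0`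
  (`H ⊓ D_𝔭 ≤ H`), onto the `p`-torsion by the Kummer lift `exists_torsionToPrimaryH1Sub_eq`; so the two
  groups have the same cardinality (`Nat.card`, `0` if infinite);
* §1 `natCard_residualSelmer_eq_of_addEquiv`: `R_𝔭^Σ(L, M) ≃ R_𝔭^Σ(L, M′)` along a `Γ_K`-equivariant
  `M ≃+ M′` (the bijection behind `finite_residualSelmer_iff_of_addEquiv`), as an equality of `Nat.card`;
* §3 (L) transports along `E₁[p] ≅ E₂[p]` (`noFixedPTorsion_of_torsionIso`: `E[p^∞]^D` has no `p`-torsion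
  iff `E[p]^D = 0`, a property of `E[p]|_D`), whence the TWO-CURVE EXACT COMPARISON
  `natCard_selmerAc_pTorsion_eq_of_torsionIso` / `natCard_selmerAc_pTorsion_baseChange_eq_of_modPCongruent`:
  `#Sel_𝔭^Σ(K_∞, E₁[p^∞])[p] = #Sel_𝔭^Σ(K_∞, E₂[p^∞])[p]` for `p`-congruent curves under (L) for ONE of them
  (Greenberg–Vatsal Prop. (2.8) «`Sel(E₁[p]) ≅ Sel(E₂[p])` and `Sel(E_i[p]) = Sel(E_i[p^∞])[p]` when
  `E(ℚ_∞)[p] = 0`», here for Castella's anticyclotomic conditions, where the hypothesis at the strict place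
  replaces GV's ordinary bookkeeping). On the crux's habitat (L) reads `E(ℚ₃)[3] = 0` (PRICING §2 (L), §6′:
  1 817 of the 2 023 twin-having classes); without (L) the comparison is only exact up to the finite defect
  `E(K_{∞,𝔭})[3^∞]/3` and this file says nothing.

HONEST STATUS: mechanism theorems toward the λ-part of 21845; the λ-transfer itself still needs «no finite
Λ-submodule» (N1) and the `Σ`-correction terms, and 21845 needs its analytic half. THEOREMS ONLY; no
definition, no named fact, no `sorry`. BSD is not advanced by this file.
References: [GreenbergVatsal2000] §2 Prop. (2.8) and p. 26; [GreenbergLNM1716] §3 (proof of Lemma 3.1), §5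
p. 114; [LimSujatha2018] §3 Prop. 3.2 (proof); [Castella2018] Def. 2.2.
-/

set_option autoImplicit false
-- `…BirchSwinnertonDyer.BirchSwinnertonDyer.Theorems…` is the problem's mandated namespace (D-0017).
set_option linter.dupNamespace false

noncomputable section

open scoped Classical

namespace Summit.BirchSwinnertonDyer.BirchSwinnertonDyer.Theorems.UniversalToricDescentResidualSelmerExact

open NumberField IsDedekindDomain Field
open Literature.NumberTheory.EllipticCurves Literature.NumberTheory.EllipticCurves.GreenbergSelmer
  Literature.NumberTheory.EllipticCurves.GreenbergVatsal2000
  Literature.NumberTheory.EllipticCurves.FineSelmerCoefficientMap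
  Literature.NumberTheory.GaloisRepresentations WeierstrassCurve
  Summit.BirchSwinnertonDyer.Rank1Residual.X11b Summit.BirchSwinnertonDyer.Rank1Residual.X11b.AcSelmer
  Summit.BirchSwinnertonDyer.Rank1Residual.O5.HeegnerLogTransport
  Summit.BirchSwinnertonDyer.BirchSwinnertonDyer.Theorems.UniversalToricDescentResidualSelmer
  Summit.BirchSwinnertonDyer.BirchSwinnertonDyer.Theorems.UniversalToricDescentResidualSelmerFinite
  Summit.BirchSwinnertonDyer.BirchSwinnertonDyer.Theorems.UniversalToricDescentResidualSelmerComparison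
  Summit.BirchSwinnertonDyer.BirchSwinnertonDyer.Theorems.UniversalToricDescentResidualSelmerLocal
  Summit.BirchSwinnertonDyer.BirchSwinnertonDyer.Theorems.UniversalToricDescentResidualSelmerTransfer

variable {K : Type} [Field K] [NumberField K]

/-! ### §1 `R_𝔭^Σ(L, M) ≃ R_𝔭^Σ(L, M′)` along an equivariant isomorphism of coefficients: cardinalities -/

section Residual

variable {M : Type} [AddCommGroup M] [DistribMulAction (absoluteGaloisGroup K) M]
  [TopologicalSpace M] [DiscreteTopology M]
variable {M' : Type} [AddCommGroup M'] [DistribMulAction (absoluteGaloisGroup K) M']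
  [TopologicalSpace M'] [DiscreteTopology M']

variable (H : Subgroup (absoluteGaloisGroup K)) [H.Normal] (p : ℕ) (𝔭 : HeightOneSpectrum (𝓞 K))
  (S₀ : Set (HeightOneSpectrum (𝓞 K)))

/-- **`#R_𝔭^Σ(L, M) = #R_𝔭^Σ(L, M′)` for a `Γ_K`-equivariant additive isomorphism `ψ : M ≃ M′`**: `ψ_*` and
`(ψ⁻¹)_*` are mutually inverse on `H¹(H, ·)` (`resH1Hom_id_symm_comp`) and preserve the residual groups
(`resH1Hom_id_mem_residualSelmer`), so they restrict to a bijection. (Greenberg–Vatsal p. 26: the Selmer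
groups of `E₁[p] ≅ E₂[p]` "are then isomorphic".) [cite: GreenbergVatsal2000, §2 p. 26]
[cite: LimSujatha2018, §3 Prop. 3.2 (proof)] -/
theorem natCard_residualSelmer_eq_of_addEquiv (ψ : M ≃+ M')
    (hψ' : ∀ (g : absoluteGaloisGroup K) (m : M), ψ (g • m) = g • ψ m) :
    Nat.card (datumStrictSelmer H M p (AcSelmer.bdpData M p 𝔭) S₀) =
      Nat.card (datumStrictSelmer H M' p (AcSelmer.bdpData M' p 𝔭) S₀) := by
  have hψs' : ∀ (g : absoluteGaloisGroup K) (m : M'), ψ.symm (g • m) = g • ψ.symm m := fun g m ↦ by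
    apply ψ.injective
    rw [ψ.apply_symm_apply, hψ', ψ.apply_symm_apply]
  have hψ : ∀ (x : H) (m : M),
      (ψ : M →+ M') (ContinuousMonoidHom.id H x • m) = x • (ψ : M →+ M') m :=
    fun x m ↦ hψ' x m
  have hψs : ∀ (x : H) (m : M'),
      (ψ.symm : M' →+ M) (ContinuousMonoidHom.id H x • m) = x • (ψ.symm : M' →+ M) m :=
    fun x m ↦ hψs' x m
  set F := resH1Hom (ContinuousMonoidHom.id H) (ψ : M →+ M') hψ with hF
  set G := resH1Hom (ContinuousMonoidHom.id H) (ψ.symm : M' →+ M) hψs with hG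
  have hGF : ∀ c, G (F c) = c := fun c ↦
    congrArg (fun f : subgroupH1 H M →+ subgroupH1 H M ↦ f c) (resH1Hom_id_symm_comp H ψ hψ hψs)
  have hFG : ∀ c, F (G c) = c := fun c ↦ by
    have e := resH1Hom_id_symm_comp H ψ.symm hψs
      (fun x m ↦ by rw [AddEquiv.symm_symm]; exact hψ x m)
    have e' := congrArg (fun f : subgroupH1 H M' →+ subgroupH1 H M' ↦ f c) e
    simp only [AddMonoidHom.comp_apply, AddMonoidHom.id_apply] at e'
    rw [hF]
    convert e' using 2
    exact resH1Hom_congr rfl (by rw [AddEquiv.symm_symm]) _ _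
  have hFmem : ∀ c ∈ datumStrictSelmer H M p (AcSelmer.bdpData M p 𝔭) S₀,
      F c ∈ datumStrictSelmer H M' p (AcSelmer.bdpData M' p 𝔭) S₀ := fun c hc ↦
    resH1Hom_id_mem_residualSelmer H p 𝔭 S₀ (ψ : M →+ M') (fun g m ↦ hψ' g m) hψ hc
  have hGmem : ∀ c ∈ datumStrictSelmer H M' p (AcSelmer.bdpData M' p 𝔭) S₀,
      G c ∈ datumStrictSelmer H M p (AcSelmer.bdpData M p 𝔭) S₀ := fun c hc ↦
    resH1Hom_id_mem_residualSelmer H p 𝔭 S₀ (ψ.symm : M' →+ M) (fun g m ↦ hψs' g m) hψs hc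
  exact Nat.card_congr
    { toFun := fun c ↦ ⟨F c, hFmem c c.2⟩
      invFun := fun c ↦ ⟨G c, hGmem c c.2⟩
      left_inv := fun c ↦ Subtype.ext (hGF c)
      right_inv := fun c ↦ Subtype.ext (hFG c) }

end Residual

/-! ### §2 One curve: `ι⁻¹(Sel_𝔭^Σ(K_∞, E[p^∞])) = R_𝔭^Σ(K_∞, E[p])` and `R ≃ Sel[p]` under (L) -/

section OneCurve

variable (W : WeierstrassCurve K) [W.IsElliptic] {p : ℕ} [Fact p.Prime] (κ : ZpExtension K p)

/-- **`ι⁻¹(Sel_𝔭^Σ(K_∞, E[p^∞])) = R_𝔭^Σ(K_∞, E[p])` under (L).** For `p` odd, `𝔭 ∋ p`, `Σ` containing the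
bad places prime to `p`, and `E[p^∞]^{H ⊓ D_𝔭}` without `p`-torsion (`H = Gal(K̄/K_∞)`), a class
`y ∈ H¹(K_∞, E[p])` maps into Castella's Selmer group iff it is residual-Selmer: «locally trivial» for
`ι y` at a good `v ∉ Σ` ⟺ «unramified» for `y` (`mem_unramifiedKer_of_torsionToPrimaryH1Sub_mem_awayKer`,
`torsionToPrimaryH1Sub_mem_awayKer_of_mem_unramifiedKer_kerSubgroup`); at `𝔭` the strict conditions
correspond because `H¹(H ⊓ D_𝔭, E[p]) → H¹(H ⊓ D_𝔭, E[p^∞])` is injective under (L)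
(`torsionToPrimaryH1Sub_injective_of_fixed`); no condition elsewhere above `p`; vacuous at `∞`.
[cite: GreenbergVatsal2000, §2 Prop. (2.8) (proof, pp. 26–27)] [cite: GreenbergLNM1716, §3 (proof of Lemma 3.1)] -/
theorem comap_torsionToPrimaryH1Sub_selmerAc_eq_residualSelmer (hp : p ≠ 2)
    {𝔭 : HeightOneSpectrum (𝓞 K)} (h𝔭 : ((p : ℕ) : 𝓞 K) ∈ 𝔭.asIdeal) {S : Set (HeightOneSpectrum (𝓞 K))}
    (hS : ∀ v : HeightOneSpectrum (𝓞 K), v ∉ S → ((p : ℕ) : 𝓞 K) ∉ v.asIdeal → W.HasGoodReductionAt v)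
    (hL : ∀ m : W.geomPrimaryTorsion p,
      (∀ σ ∈ κ.kerSubgroup ⊓ decomp 𝔭, σ • m = m) → p • m = 0 → m = 0) :
    (selmerAc W p κ 𝔭 S).comap (W.torsionToPrimaryH1Sub p κ.kerSubgroup) =
      datumStrictSelmer κ.kerSubgroup (W.geomTorsion (p : ℤ)) p (AcSelmer.bdpData _ p 𝔭) S := by
  ext y
  rw [AddSubgroup.mem_comap]
  constructor
  · intro hy
    have hyS := (mem_selmerOver_iff _).mp hy
    rw [mem_datumStrictSelmer_iff, mem_unramifiedOutside_iff]
    refine ⟨fun v hvS hpv σ ↦ ?_, fun v hv σ ↦ ?_⟩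
    · -- good place outside `Σ`: locally trivial ⟹ unramified
      have hpv' : (p : 𝓞 K) ∉ v.asIdeal := hpv
      refine mem_unramifiedKer_of_torsionToPrimaryH1Sub_mem_awayKer W p κ.kerSubgroup (hS v hvS hpv)
        hpv' ?_
      rw [← WeierstrassCurve.conjH1_torsionToPrimaryH1Sub]
      exact hyS.1 v hpv hvS σ
    · by_cases hv𝔭 : v = 𝔭
      · -- the strict place: the local Kummer kernel vanishes under (L)
        subst hv𝔭
        rw [AcSelmer.bdpData_self p v hv,
          show AcSelmer.strictDatum (↥(W.geomTorsion (p : ℤ))) v =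
            fineLocalDatum (↥(W.geomTorsion (p : ℤ))) v from rfl,
          mem_strictKer_fineLocalDatum_iff]
        have h := hyS.2.2 σ
        rw [WeierstrassCurve.conjH1_torsionToPrimaryH1Sub,
          show AcSelmer.strictDatum (↥(W.geomPrimaryTorsion p)) v =
            fineLocalDatum (↥(W.geomPrimaryTorsion p)) v from rfl,
          mem_strictKer_fineLocalDatum_iff, FineSelmerCoefficientMap.resOfLe_torsionToPrimaryH1Sub] at h
        exact torsionToPrimaryH1Sub_injective_of_fixed W p _ hL (by rw [h, map_zero])
      · -- the other places above `p`: relaxed, no condition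
        rw [AcSelmer.bdpData_of_ne p 𝔭 hv hv𝔭, AcSelmer.strictKer_relaxedDatum_eq_top]
        exact AddSubgroup.mem_top _
  · intro hy
    exact torsionToPrimaryH1Sub_mem_selmerAc_of_mem_residualSelmer W κ hp h𝔭
      (fun v hvS hpv _ hy' ↦
        torsionToPrimaryH1Sub_mem_awayKer_of_mem_unramifiedKer_kerSubgroup W p κ hpv (hS v hvS hpv) hy')
      hy

/-- **`#R_𝔭^Σ(K_∞, E[p]) = #Sel_𝔭^Σ(K_∞, E[p^∞])[p]` under (L)**: `ι` is injective on `H¹(K_∞, E[p])`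
(`E(K_∞)[p] ⊆ E(K_{∞,𝔭})[p] = 0`, `torsionToPrimaryH1Sub_injective_of_fixed`), maps `R` into the
`p`-torsion of `Sel` (§2 and `p_smul_torsionToPrimaryH1Sub_eq_zero`), and every `p`-torsion Selmer class
lifts (`exists_torsionToPrimaryH1Sub_eq`) to a class which lies in `R` by §2: a bijection
`R_𝔭^Σ(K_∞, E[p]) ≃ Sel_𝔭^Σ(K_∞, E[p^∞])[p]`. [cite: GreenbergVatsal2000, §2 Prop. (2.8)]
[cite: GreenbergLNM1716, §5 p. 114] -/
theorem natCard_residualSelmer_eq_natCard_selmerAc_pTorsion (hp : p ≠ 2)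
    {𝔭 : HeightOneSpectrum (𝓞 K)} (h𝔭 : ((p : ℕ) : 𝓞 K) ∈ 𝔭.asIdeal) {S : Set (HeightOneSpectrum (𝓞 K))}
    (hS : ∀ v : HeightOneSpectrum (𝓞 K), v ∉ S → ((p : ℕ) : 𝓞 K) ∉ v.asIdeal → W.HasGoodReductionAt v)
    (hL : ∀ m : W.geomPrimaryTorsion p,
      (∀ σ ∈ κ.kerSubgroup ⊓ decomp 𝔭, σ • m = m) → p • m = 0 → m = 0) :
    Nat.card (datumStrictSelmer κ.kerSubgroup (W.geomTorsion (p : ℤ)) p (AcSelmer.bdpData _ p 𝔭) S) =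
      Nat.card {s : selmerAc W p κ 𝔭 S // p • s = 0} := by
  have hcomap := comap_torsionToPrimaryH1Sub_selmerAc_eq_residualSelmer W κ hp h𝔭 hS hL
  have hG : ∀ m : W.geomPrimaryTorsion p, (∀ σ ∈ κ.kerSubgroup, σ • m = m) → p • m = 0 → m = 0 :=
    fun m hm hpm ↦ hL m (fun σ hσ ↦ hm σ (Subgroup.mem_inf.mp hσ).1) hpm
  have hinj := torsionToPrimaryH1Sub_injective_of_fixed W p κ.kerSubgroup hG
  have hmem : ∀ y ∈ datumStrictSelmer κ.kerSubgroup (W.geomTorsion (p : ℤ)) p (AcSelmer.bdpData _ p 𝔭) S,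
      W.torsionToPrimaryH1Sub p κ.kerSubgroup y ∈ selmerAc W p κ 𝔭 S := fun y hy ↦ by
    have h : y ∈ (selmerAc W p κ 𝔭 S).comap (W.torsionToPrimaryH1Sub p κ.kerSubgroup) := by
      rw [hcomap]; exact hy
    exact h
  have htor : ∀ y : datumStrictSelmer κ.kerSubgroup (W.geomTorsion (p : ℤ)) p (AcSelmer.bdpData _ p 𝔭) S,
      p • (⟨W.torsionToPrimaryH1Sub p κ.kerSubgroup y, hmem y y.2⟩ : selmerAc W p κ 𝔭 S) = 0 :=
    fun y ↦ Subtype.ext (by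
      rw [AddSubgroupClass.coe_nsmul, ZeroMemClass.coe_zero]
      exact p_smul_torsionToPrimaryH1Sub_eq_zero W κ.kerSubgroup _)
  let f : datumStrictSelmer κ.kerSubgroup (W.geomTorsion (p : ℤ)) p (AcSelmer.bdpData _ p 𝔭) S →
      {s : selmerAc W p κ 𝔭 S // p • s = 0} :=
    fun y ↦ ⟨⟨W.torsionToPrimaryH1Sub p κ.kerSubgroup y, hmem y y.2⟩, htor y⟩
  refine Nat.card_congr (Equiv.ofBijective f ⟨fun y₁ y₂ h ↦ ?_, fun s ↦ ?_⟩)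
  · have h' := congrArg (fun s : {s : selmerAc W p κ 𝔭 S // p • s = 0} ↦
      ((s.1 : selmerAc W p κ 𝔭 S) : W.subgroupH1 p κ.kerSubgroup)) h
    exact Subtype.ext (hinj h')
  · obtain ⟨s, hs⟩ := s
    have hs' : p • (s : W.subgroupH1 p κ.kerSubgroup) = 0 := by
      rw [← AddSubgroupClass.coe_nsmul, hs, ZeroMemClass.coe_zero]
    obtain ⟨x, hx⟩ := W.exists_torsionToPrimaryH1Sub_eq p W.zsmul_geomPoints_surjective_holds hs'
    have hxR : x ∈ datumStrictSelmer κ.kerSubgroup (W.geomTorsion (p : ℤ)) p (AcSelmer.bdpData _ p 𝔭) S := by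
      rw [← hcomap, AddSubgroup.mem_comap, hx]
      exact s.2
    exact ⟨⟨x, hxR⟩, Subtype.ext (Subtype.ext hx)⟩

end OneCurve

/-! ### §3 Two curves with `E₁[p] ≅ E₂[p]`: (L) transports, and the exact comparison -/

section TwoCurves

variable {p : ℕ} [Fact p.Prime]

omit [NumberField K] [Fact p.Prime] in
/-- **(L) is a property of `E[p]|_D`**: if `E₁[p] ≅ E₂[p]` `Γ_K`-equivariantly and `E₁[p^∞]^D` has no
`p`-torsion (`D ≤ Γ_K` any subgroup), then neither has `E₂[p^∞]^D` — a `D`-fixed `m ∈ E₂[p^∞]` with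
`p m = 0` lies in `E₂[p]^D ≅ E₁[p]^D ⊆ E₁[p^∞]^D[p] = 0`. (So (L) at the strict place holds for the twin
iff it holds for the curve: PRICING §2 (L), "the same statement with the SAME right-hand side holds for
`E′`".) [cite: GreenbergVatsal2000, §2 p. 26] -/
theorem noFixedPTorsion_of_torsionIso (W₁ W₂ : WeierstrassCurve K) (D : Subgroup (absoluteGaloisGroup K))
    (e : W₁.geomTorsion (p : ℤ) ≃+ W₂.geomTorsion (p : ℤ))
    (he : ∀ (σ : absoluteGaloisGroup K) (P : W₁.geomTorsion (p : ℤ)), e (σ • P) = σ • e P)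
    (h₁ : ∀ m : W₁.geomPrimaryTorsion p, (∀ σ ∈ D, σ • m = m) → p • m = 0 → m = 0) :
    ∀ m : W₂.geomPrimaryTorsion p, (∀ σ ∈ D, σ • m = m) → p • m = 0 → m = 0 := by
  intro m hm hpm
  -- `m ∈ E₂[p]`
  have hmtor : ((m : W₂.geomPrimaryTorsion p) : W₂.geomPoints) ∈ W₂.geomTorsion (p : ℤ) :=
    AddSubgroup.torsionBy.nsmul_iff.mpr (by
      rw [← AddSubgroupClass.coe_nsmul, hpm, ZeroMemClass.coe_zero])
  set P₂ : W₂.geomTorsion (p : ℤ) := ⟨_, hmtor⟩ with hP₂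
  have hP₂fix : ∀ σ ∈ D, σ • P₂ = P₂ := fun σ hσ ↦ Subtype.ext (by
    rw [AddSubgroup.torsionBy.coe_smul, hP₂]
    have h := congrArg (fun z : W₂.geomPrimaryTorsion p ↦ (z : W₂.geomPoints)) (hm σ hσ)
    simpa only [primaryComponent.coe_smul] using h)
  -- transport to `E₁[p]`, then into `E₁[p^∞]`
  set P₁ : W₁.geomTorsion (p : ℤ) := e.symm P₂ with hP₁
  have hP₁fix : ∀ σ ∈ D, σ • P₁ = P₁ := fun σ hσ ↦ e.injective (by
    rw [he, hP₁, e.apply_symm_apply, hP₂fix σ hσ])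
  set Q₁ : W₁.geomPrimaryTorsion p :=
    AddSubgroup.inclusion (geomTorsion_le_geomPrimaryTorsion W₁ p) P₁ with hQ₁
  have hQ₁fix : ∀ σ ∈ D, σ • Q₁ = Q₁ := fun σ hσ ↦ Subtype.ext (by
    rw [primaryComponent.coe_smul, hQ₁, AddSubgroup.coe_inclusion, ← AddSubgroup.torsionBy.coe_smul,
      hP₁fix σ hσ])
  have hQ₁p : p • Q₁ = 0 := Subtype.ext (by
    rw [AddSubgroupClass.coe_nsmul, hQ₁, AddSubgroup.coe_inclusion, ZeroMemClass.coe_zero,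
      ← natCast_zsmul]
    exact P₁.2)
  have hQ₁0 : Q₁ = 0 := h₁ Q₁ hQ₁fix hQ₁p
  have hP₁0 : P₁ = 0 := by
    apply Subtype.ext
    have h := congrArg (fun z : W₁.geomPrimaryTorsion p ↦ (z : W₁.geomPoints)) hQ₁0
    simpa only [hQ₁, AddSubgroup.coe_inclusion, ZeroMemClass.coe_zero] using h
  have hP₂0 : P₂ = 0 := by
    rw [show P₂ = e P₁ by rw [hP₁, e.apply_symm_apply], hP₁0, map_zero]
  apply Subtype.ext
  have h := congrArg (fun z : W₂.geomTorsion (p : ℤ) ↦ (z : W₂.geomPoints)) hP₂0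
  simpa only [hP₂, ZeroMemClass.coe_zero] using h

variable (κ : ZpExtension K p)

/-- **The two-curve exact residual comparison.** For elliptic curves `E₁, E₂` over the number field `K`
with a `Γ_K`-equivariant `E₁[p] ≃+ E₂[p]`, `p` odd, `𝔭 ∋ p`, `Σ ∌ 𝔭` containing the bad places of both
curves prime to `p`, over ANY `ℤ_p`-extension `K_∞` in which `E₁(K_{∞,𝔭})[p] = 0` (L):
`#Sel_𝔭^Σ(K_∞, E₁[p^∞])[p] = #Sel_𝔭^Σ(K_∞, E₂[p^∞])[p]` — both equal `#R_𝔭^Σ(K_∞, E₁[p]) = #R_𝔭^Σ(K_∞, E₂[p])`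
(§2 for each curve, (L) for `E₂` by `noFixedPTorsion_of_torsionIso`, §1 for the middle).
Greenberg–Vatsal Prop. (2.8) for Castella's anticyclotomic Selmer groups.
[cite: GreenbergVatsal2000, §2 Prop. (2.8)] -/
theorem natCard_selmerAc_pTorsion_eq_of_torsionIso (W₁ W₂ : WeierstrassCurve K) [W₁.IsElliptic]
    [W₂.IsElliptic] (hp : p ≠ 2) {𝔭 : HeightOneSpectrum (𝓞 K)} (h𝔭 : ((p : ℕ) : 𝓞 K) ∈ 𝔭.asIdeal)
    {S : Set (HeightOneSpectrum (𝓞 K))}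
    (hS₁ : ∀ v : HeightOneSpectrum (𝓞 K), v ∉ S → ((p : ℕ) : 𝓞 K) ∉ v.asIdeal → W₁.HasGoodReductionAt v)
    (hS₂ : ∀ v : HeightOneSpectrum (𝓞 K), v ∉ S → ((p : ℕ) : 𝓞 K) ∉ v.asIdeal → W₂.HasGoodReductionAt v)
    (e : W₁.geomTorsion (p : ℤ) ≃+ W₂.geomTorsion (p : ℤ))
    (he : ∀ (σ : absoluteGaloisGroup K) (P : W₁.geomTorsion (p : ℤ)), e (σ • P) = σ • e P)
    (hL : ∀ m : W₁.geomPrimaryTorsion p,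
      (∀ σ ∈ κ.kerSubgroup ⊓ decomp 𝔭, σ • m = m) → p • m = 0 → m = 0) :
    Nat.card {s : selmerAc W₁ p κ 𝔭 S // p • s = 0} = Nat.card {s : selmerAc W₂ p κ 𝔭 S // p • s = 0} := by
  have hL₂ := noFixedPTorsion_of_torsionIso W₁ W₂ _ e he hL
  rw [← natCard_residualSelmer_eq_natCard_selmerAc_pTorsion W₁ κ hp h𝔭 hS₁ hL,
    ← natCard_residualSelmer_eq_natCard_selmerAc_pTorsion W₂ κ hp h𝔭 hS₂ hL₂]
  exact natCard_residualSelmer_eq_of_addEquiv κ.kerSubgroup p 𝔭 S e he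

end TwoCurves

/-! ### §4 The route's instance: `W, W′` over `ℚ`, `ModPCongruent W′ W p`, base-changed to `K` -/

section Route

variable {p : ℕ} [Fact p.Prime]

/-- **Exact residual comparison for the route's twin.** For `W, W′/ℚ` with `W′[p] ≅ W[p]`
(`ModPCongruent W′ W p`), a number field `K`, ANY `ℤ_p`-extension `κ` of `K`, `p` odd, `𝔭 ∋ p`, `Σ ∌ 𝔭`
containing the bad places of `W_K` and `W′_K` prime to `p`, and (L) `W(K_{∞,𝔭})[p] = 0`:
`#Sel_𝔭^Σ(K_∞, W_K[p^∞])[p] = #Sel_𝔭^Σ(K_∞, W′_K[p^∞])[p]`. In the crux's binders (`p = 3`, `K` the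
Heegner field, `κ` anticyclotomic, strict place `𝔭′`) this is step (X) of the λ-transfer for child 21845.
[cite: GreenbergVatsal2000, §2 Prop. (2.8)] -/
theorem natCard_selmerAc_pTorsion_baseChange_eq_of_modPCongruent (W W' : WeierstrassCurve ℚ)
    [W.IsElliptic] [W'.IsElliptic] (K : Type) [Field K] [NumberField K] (κ : ZpExtension K p)
    (hp : p ≠ 2) {𝔭 : HeightOneSpectrum (𝓞 K)} (h𝔭 : ((p : ℕ) : 𝓞 K) ∈ 𝔭.asIdeal)
    {S : Set (HeightOneSpectrum (𝓞 K))}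
    (hS : ∀ v : HeightOneSpectrum (𝓞 K), v ∉ S → ((p : ℕ) : 𝓞 K) ∉ v.asIdeal →
      (W.baseChange K).HasGoodReductionAt v)
    (hS' : ∀ v : HeightOneSpectrum (𝓞 K), v ∉ S → ((p : ℕ) : 𝓞 K) ∉ v.asIdeal →
      (W'.baseChange K).HasGoodReductionAt v)
    (hcong : Summit.BirchSwinnertonDyer.Rank1Residual.O6.ModPCongruent W' W p)
    (hL : ∀ m : (W.baseChange K).geomPrimaryTorsion p,
      (∀ σ ∈ κ.kerSubgroup ⊓ decomp 𝔭, σ • m = m) → p • m = 0 → m = 0) :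
    Nat.card {s : selmerAc (W.baseChange K) p κ 𝔭 S // p • s = 0} =
      Nat.card {s : selmerAc (W'.baseChange K) p κ 𝔭 S // p • s = 0} := by
  obtain ⟨e, he⟩ := exists_torsionIso_baseChange_of_modPCongruent (K := K) W W' hcong
  have hes : ∀ (σ : absoluteGaloisGroup K) (P : (W.baseChange K).geomTorsion (p : ℤ)),
      e.symm (σ • P) = σ • e.symm P := fun σ P ↦ by
    apply e.injective
    rw [e.apply_symm_apply, he, e.apply_symm_apply]
  exact natCard_selmerAc_pTorsion_eq_of_torsionIso κ (W.baseChange K) (W'.baseChange K) hp h𝔭 hS hS'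
    e.symm hes hL

end Route

end Summit.BirchSwinnertonDyer.BirchSwinnertonDyer.Theorems.UniversalToricDescentResidualSelmerExact

end
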